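import Summits.MatrixMultiplication.MatrixMultiplication.Theorems.AsymptoticRankCWSkewPencilDichotomy

/-!
# The torus pencil through `T_cw,2` and `ε`, IV: the dihedral symmetry `ρ ↦ ζρ`, `ρ ↦ ρ⁻¹`
(route `MatrixMultiplication/AsymptoticRankCW`; support item `BSkewDominatesCw` =
stmt-MatrixMultiplication-18009, stub `stub_skewDominatesCw` of the line `skew_anchor` of the crux
`BThesis` = stmt-MatrixMultiplication-0588)

`T_ρ (a, a+1, a+2) = 1`, `T_ρ (a, a+2, a+1) = ρ` (inline), `T_1 ≅ T_cw,2`, `T_{-1} = ε`.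

The asymptotic rank along the pencil is invariant under the dihedral group generated by
`ρ ↦ ζρ` (`ζ³ = 1`; torus rescaling `a ↦ ζ^{2a} a`, `b ↦ ζ^{b} b` multiplies `T_ρ` into `ζ · T_{ζρ}`,
`pencil_restrictsTo_pencil_cubeRoot`) and `ρ ↦ ρ⁻¹` (relabelling all three factors by the
transposition `(1 2)` swaps the even and odd cells: `T_ρ ∘ σ³ = ρ · T_{ρ⁻¹}`,
`pencil_restrictsTo_pencil_inv`): `asymptoticRank_pencil_cubeRoot_mul`, `asymptoticRank_pencil_inv`.
Hence the three points `ρ³ = 1` all carry the value `R̃(T_cw,2)` and the three points `ρ³ = -1`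
carry `R̃(ε)` (`asymptoticRank_pencil_of_cube_eq_one`, `asymptoticRank_pencil_of_cube_eq_neg_one`),
and the exceptional set / the sublevel sets of parts I–II are stable under both maps
(`pencil_sublevel_cubeRoot_iff`, `pencil_sublevel_inv_iff`). The two anchors `ρ = ±1` of item 18009
are exactly the fixed points of `ρ ↦ ρ⁻¹`: the orbifold points of the quotient of the pencil by this
symmetry.

References: A. Conner, F. Gesmundo, J. M. Landsberg, E. Ventura, comput. complexity 31 (2022) =
arXiv:1909.04785, §3.2; P. Bürgisser, M. Clausen, M. A. Shokrollahi, *Algebraic Complexity Theory*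
(1997), §14.6 (relabelling and scaling are restrictions).
-/

set_option linter.dupNamespace false

noncomputable section

namespace Summit.MatrixMultiplication.MatrixMultiplication.Theorems

open Literature.Computability.AlgebraicComplexity
open Literature.Barriers.MatrixMultiplication (asymptoticRank_le_of_polyDegeneratesTo)

/-! ## `ρ ↦ ρ⁻¹`: relabelling by the transposition `(1 2)` on all three factors -/

section Inversion

/-- Relabelling all three indices by the transposition `(1 2)` swaps the even and the odd cells:
`T_ρ (σa, σb, σc) = [odd](a,b,c) + ρ [even](a,b,c)`. [folklore] -/
theorem pencil_comp_swap (ρ : ℂ) :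
    (fun a b c : Fin 3 =>
      (fun a b c : Fin 3 => (if b = a + 1 ∧ c = a + 2 then (1 : ℂ) else 0) +
        ρ * (if b = a + 2 ∧ c = a + 1 then (1 : ℂ) else 0))
        (Equiv.swap (1 : Fin 3) 2 a) (Equiv.swap (1 : Fin 3) 2 b) (Equiv.swap (1 : Fin 3) 2 c)) =
      fun a b c : Fin 3 => (if b = a + 2 ∧ c = a + 1 then (1 : ℂ) else 0) +
        ρ * (if b = a + 1 ∧ c = a + 2 then (1 : ℂ) else 0) := by
  funext a b c
  fin_cases a <;> fin_cases b <;> fin_cases c <;> simp [Equiv.swap_apply_def]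

/-- For `ρ ≠ 0`, the swapped tensor is `ρ · T_{ρ⁻¹}`. [folklore] -/
theorem pencil_swapped_eq_mul_inv {ρ : ℂ} (hρ : ρ ≠ 0) :
    (fun a b c : Fin 3 => (if b = a + 2 ∧ c = a + 1 then (1 : ℂ) else 0) +
        ρ * (if b = a + 1 ∧ c = a + 2 then (1 : ℂ) else 0)) =
      fun a b c : Fin 3 => ρ * (fun a b c : Fin 3 => (if b = a + 1 ∧ c = a + 2 then (1 : ℂ) else 0) +
        ρ⁻¹ * (if b = a + 2 ∧ c = a + 1 then (1 : ℂ) else 0)) a b c := by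
  funext a b c
  simp only [mul_add, ← mul_assoc, mul_inv_cancel₀ hρ, one_mul]
  ring

/-- **`T_ρ ≥ T_{ρ⁻¹}`** for `ρ ≠ 0`: relabel by `(1 2)³` (a restriction), obtaining `ρ · T_{ρ⁻¹}`, and
remove the non-zero scalar. [folklore] -/
theorem pencil_restrictsTo_pencil_inv {ρ : ℂ} (hρ : ρ ≠ 0) :
    TensorRestrictsTo
      (fun a b c : Fin 3 => (if b = a + 1 ∧ c = a + 2 then (1 : ℂ) else 0) +
        ρ * (if b = a + 2 ∧ c = a + 1 then (1 : ℂ) else 0))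
      (fun a b c : Fin 3 => (if b = a + 1 ∧ c = a + 2 then (1 : ℂ) else 0) +
        ρ⁻¹ * (if b = a + 2 ∧ c = a + 1 then (1 : ℂ) else 0)) := by
  have h1 := tensorRestrictsTo_precomp
    (fun a b c : Fin 3 => (if b = a + 1 ∧ c = a + 2 then (1 : ℂ) else 0) +
      ρ * (if b = a + 2 ∧ c = a + 1 then (1 : ℂ) else 0))
    (Equiv.swap (1 : Fin 3) 2) (Equiv.swap (1 : Fin 3) 2) (Equiv.swap (1 : Fin 3) 2)
  rw [pencil_comp_swap ρ, pencil_swapped_eq_mul_inv hρ] at h1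
  exact h1.trans (tensorRestrictsTo_of_const_mul _ hρ)

/-- **`R̃(T_{ρ⁻¹}) = R̃(T_ρ)`** for `ρ ≠ 0`. [folklore] -/
theorem asymptoticRank_pencil_inv {ρ : ℂ} (hρ : ρ ≠ 0) :
    asymptoticRank (fun a b c : Fin 3 => (if b = a + 1 ∧ c = a + 2 then (1 : ℂ) else 0) +
        ρ⁻¹ * (if b = a + 2 ∧ c = a + 1 then (1 : ℂ) else 0)) =
      asymptoticRank (fun a b c : Fin 3 => (if b = a + 1 ∧ c = a + 2 then (1 : ℂ) else 0) +
        ρ * (if b = a + 2 ∧ c = a + 1 then (1 : ℂ) else 0)) := by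
  refine le_antisymm (asymptoticRank_le_of_polyDegeneratesTo
    (pencil_restrictsTo_pencil_inv hρ).polyDegeneratesTo) ?_
  have h := pencil_restrictsTo_pencil_inv (inv_ne_zero hρ)
  rw [inv_inv] at h
  exact asymptoticRank_le_of_polyDegeneratesTo h.polyDegeneratesTo

end Inversion

/-! ## `ρ ↦ ζρ`, `ζ³ = 1`: torus rescaling -/

section CubeRoots

/-- **`T_ρ ≥ T_{ζρ}` for every cube root of unity `ζ`**: the diagonal change of bases
`a ↦ ζ^{2a} a`, `b ↦ ζ^{b} b` (`c` fixed) multiplies the even cells by `ζ` and the odd cells by `ζ²`,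
i.e. gives `ζ · T_{ζρ}`; then remove the scalar `ζ ≠ 0`. [folklore] -/
theorem pencil_restrictsTo_pencil_cubeRoot {ζ : ℂ} (hζ : ζ ^ 3 = 1) (ρ : ℂ) :
    TensorRestrictsTo
      (fun a b c : Fin 3 => (if b = a + 1 ∧ c = a + 2 then (1 : ℂ) else 0) +
        ρ * (if b = a + 2 ∧ c = a + 1 then (1 : ℂ) else 0))
      (fun a b c : Fin 3 => (if b = a + 1 ∧ c = a + 2 then (1 : ℂ) else 0) +
        (ζ * ρ) * (if b = a + 2 ∧ c = a + 1 then (1 : ℂ) else 0)) := by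
  have hζ0 : ζ ≠ 0 := by
    rintro rfl
    norm_num at hζ
  -- the diagonal rescaling is a restriction onto `ζ · T_{ζρ}`
  have hdiag : TensorRestrictsTo
      (fun a b c : Fin 3 => (if b = a + 1 ∧ c = a + 2 then (1 : ℂ) else 0) +
        ρ * (if b = a + 2 ∧ c = a + 1 then (1 : ℂ) else 0))
      (fun a b c : Fin 3 => ζ * (fun a b c : Fin 3 => (if b = a + 1 ∧ c = a + 2 then (1 : ℂ) else 0) +
        (ζ * ρ) * (if b = a + 2 ∧ c = a + 1 then (1 : ℂ) else 0)) a b c) := by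
    refine ⟨fun a' a => if a = a' then ζ ^ (2 * (a : ℕ)) else 0,
      fun b' b => if b = b' then ζ ^ (b : ℕ) else 0,
      fun c' c => if c = c' then 1 else 0, fun a' b' c' => ?_⟩
    rw [Finset.sum_eq_single a' (fun a _ ha => by simp [ha]) (by simp),
      Finset.sum_eq_single b' (fun b _ hb => by simp [hb]) (by simp),
      Finset.sum_eq_single c' (fun c _ hc => by simp [hc]) (by simp)]
    fin_cases a' <;> fin_cases b' <;> fin_cases c' <;> simp <;>
      first
        | linear_combination (-ζ) * hζ
        | linear_combination (-(ζ ^ 2 * ρ)) * hζ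
        | linear_combination (0 : ℂ) * hζ
  exact hdiag.trans (tensorRestrictsTo_of_const_mul _ hζ0)

/-- **`R̃(T_{ζρ}) = R̃(T_ρ)` for `ζ³ = 1`** (apply the restriction thrice: `ρ ↦ ζρ ↦ ζ²ρ ↦ ζ³ρ = ρ`).
[folklore] -/
theorem asymptoticRank_pencil_cubeRoot_mul {ζ : ℂ} (hζ : ζ ^ 3 = 1) (ρ : ℂ) :
    asymptoticRank (fun a b c : Fin 3 => (if b = a + 1 ∧ c = a + 2 then (1 : ℂ) else 0) +
        (ζ * ρ) * (if b = a + 2 ∧ c = a + 1 then (1 : ℂ) else 0)) =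
      asymptoticRank (fun a b c : Fin 3 => (if b = a + 1 ∧ c = a + 2 then (1 : ℂ) else 0) +
        ρ * (if b = a + 2 ∧ c = a + 1 then (1 : ℂ) else 0)) := by
  refine le_antisymm (asymptoticRank_le_of_polyDegeneratesTo
    (pencil_restrictsTo_pencil_cubeRoot hζ ρ).polyDegeneratesTo) ?_
  -- `T_{ζρ} ≥ T_{ζ²ρ} ≥ T_{ζ³ρ} = T_ρ`
  have h2 := (pencil_restrictsTo_pencil_cubeRoot hζ (ζ * ρ)).trans
    (pencil_restrictsTo_pencil_cubeRoot hζ (ζ * (ζ * ρ)))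
  have e : ζ * (ζ * (ζ * ρ)) = ρ := by
    calc ζ * (ζ * (ζ * ρ)) = ζ ^ 3 * ρ := by ring
      _ = ρ := by rw [hζ, one_mul]
  rw [e] at h2
  exact asymptoticRank_le_of_polyDegeneratesTo h2.polyDegeneratesTo

/-- **All cube roots of `1` carry the value of `T_cw,2`**: `ρ³ = 1 ⇒ R̃(T_ρ) = R̃(T_cw,2)`.
[folklore] -/
theorem asymptoticRank_pencil_of_cube_eq_one {ρ : ℂ} (hρ : ρ ^ 3 = 1) :
    asymptoticRank (fun a b c : Fin 3 => (if b = a + 1 ∧ c = a + 2 then (1 : ℂ) else 0) +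
        ρ * (if b = a + 2 ∧ c = a + 1 then (1 : ℂ) else 0)) = asymptoticRank (cwTensor ℂ 2) := by
  rw [← asymptoticRank_pencil_one, ← asymptoticRank_pencil_cubeRoot_mul hρ 1, mul_one]

/-- **All cube roots of `-1` carry the value of `ε`**: `ρ³ = -1 ⇒ R̃(T_ρ) = R̃(ε)` (`ζ = -ρ` is a cube
root of `1` and `ρ = ζ · (-1)`). [folklore] -/
theorem asymptoticRank_pencil_of_cube_eq_neg_one {ρ : ℂ} (hρ : ρ ^ 3 = -1) :
    asymptoticRank (fun a b c : Fin 3 => (if b = a + 1 ∧ c = a + 2 then (1 : ℂ) else 0) +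
        ρ * (if b = a + 2 ∧ c = a + 1 then (1 : ℂ) else 0)) =
      asymptoticRank (fun a b c : Fin 3 => (if b = a + 1 ∧ c = a + 2 then (1 : ℂ) else 0) -
        (if b = a + 2 ∧ c = a + 1 then 1 else 0)) := by
  have hζ : (-ρ) ^ 3 = 1 := by
    calc (-ρ) ^ 3 = -(ρ ^ 3) := by ring
      _ = 1 := by rw [hρ, neg_neg]
  have h := asymptoticRank_pencil_cubeRoot_mul hζ (-1)
  rw [show -ρ * (-1 : ℂ) = ρ by ring] at h
  rw [h, pencil_neg_one_eq_leviCivita]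

end CubeRoots

/-! ## Stability of the sublevel sets under the dihedral symmetry -/

section Stability

/-- The sublevel sets `{ρ : R̃(T_ρ) ≤ r}` (finite or all of `ℂ`, part I) are stable under `ρ ↦ ζρ`,
`ζ³ = 1`. [folklore] -/
theorem pencil_sublevel_cubeRoot_iff {ζ : ℂ} (hζ : ζ ^ 3 = 1) (r : ℝ) (ρ : ℂ) :
    ζ * ρ ∈ {ρ : ℂ | asymptoticRank (fun a b c : Fin 3 =>
        (if b = a + 1 ∧ c = a + 2 then (1 : ℂ) else 0) +
          ρ * (if b = a + 2 ∧ c = a + 1 then (1 : ℂ) else 0)) ≤ r} ↔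
      ρ ∈ {ρ : ℂ | asymptoticRank (fun a b c : Fin 3 =>
        (if b = a + 1 ∧ c = a + 2 then (1 : ℂ) else 0) +
          ρ * (if b = a + 2 ∧ c = a + 1 then (1 : ℂ) else 0)) ≤ r} := by
  simp only [Set.mem_setOf_eq]
  rw [asymptoticRank_pencil_cubeRoot_mul hζ ρ]

/-- The sublevel sets are stable under `ρ ↦ ρ⁻¹` on `ℂˣ`; the two anchors `ρ = ±1` compared by
item 18009 are the fixed points of this involution. [folklore] -/
theorem pencil_sublevel_inv_iff {ρ : ℂ} (hρ : ρ ≠ 0) (r : ℝ) :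
    ρ⁻¹ ∈ {ρ : ℂ | asymptoticRank (fun a b c : Fin 3 =>
        (if b = a + 1 ∧ c = a + 2 then (1 : ℂ) else 0) +
          ρ * (if b = a + 2 ∧ c = a + 1 then (1 : ℂ) else 0)) ≤ r} ↔
      ρ ∈ {ρ : ℂ | asymptoticRank (fun a b c : Fin 3 =>
        (if b = a + 1 ∧ c = a + 2 then (1 : ℂ) else 0) +
          ρ * (if b = a + 2 ∧ c = a + 1 then (1 : ℂ) else 0)) ≤ r} := by
  simp only [Set.mem_setOf_eq]
  rw [asymptoticRank_pencil_inv hρ]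

/-- The exceptional set `{ρ : R̃(T_ρ) < sup}` (countable, part II) is stable under `ρ ↦ ρ⁻¹` on `ℂˣ`
and under `ρ ↦ ζρ`: if `ρ ≠ 0` is exceptional, so are `ρ⁻¹` and `ζρ`. [folklore] -/
theorem pencil_exceptional_stable {ρ ζ : ℂ} (hρ : ρ ≠ 0) (hζ : ζ ^ 3 = 1)
    (hex : asymptoticRank (fun a b c : Fin 3 =>
        (if b = a + 1 ∧ c = a + 2 then (1 : ℂ) else 0) +
          ρ * (if b = a + 2 ∧ c = a + 1 then (1 : ℂ) else 0)) <
      ⨆ ρ' : ℂ, asymptoticRank (fun a b c : Fin 3 => (if b = a + 1 ∧ c = a + 2 then (1 : ℂ) else 0) +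
        ρ' * (if b = a + 2 ∧ c = a + 1 then (1 : ℂ) else 0))) :
    asymptoticRank (fun a b c : Fin 3 =>
        (if b = a + 1 ∧ c = a + 2 then (1 : ℂ) else 0) +
          ρ⁻¹ * (if b = a + 2 ∧ c = a + 1 then (1 : ℂ) else 0)) <
      ⨆ ρ' : ℂ, asymptoticRank (fun a b c : Fin 3 => (if b = a + 1 ∧ c = a + 2 then (1 : ℂ) else 0) +
        ρ' * (if b = a + 2 ∧ c = a + 1 then (1 : ℂ) else 0)) ∧
    asymptoticRank (fun a b c : Fin 3 =>
        (if b = a + 1 ∧ c = a + 2 then (1 : ℂ) else 0) +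
          (ζ * ρ) * (if b = a + 2 ∧ c = a + 1 then (1 : ℂ) else 0)) <
      ⨆ ρ' : ℂ, asymptoticRank (fun a b c : Fin 3 => (if b = a + 1 ∧ c = a + 2 then (1 : ℂ) else 0) +
        ρ' * (if b = a + 2 ∧ c = a + 1 then (1 : ℂ) else 0)) := by
  rw [asymptoticRank_pencil_inv hρ, asymptoticRank_pencil_cubeRoot_mul hζ ρ]
  exact ⟨hex, hex⟩

end Stability

end Summit.MatrixMultiplication.MatrixMultiplication.Theorems

end
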